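/-
COR-CM (cell pub-hodgecm2, stage 2 of the Hodge ladder) — Δ2 BRIDGE, ORIENTATION AUDIT (ASSEMBLER DECISION #13 §4, Q1),
own-crow g93 (prover-pub-hodgecm-own-crow-g93-0).  THEOREMS ONLY; nothing landed is edited or restated; no named fact, no `sorry`.
FRAMING: HC_CM is NOT proved; «Δ2 BRIDGE CLOSED» is NOT claimed.  Pure Galois/CM bookkeeping on the package admissibility predicate.
-/
import Summits.HodgeConjecture.HodgeCM.Model.Binders.JLiuCornerOfReflex
import Summits.HodgeConjecture.HodgeCM.Model.LiuCMSideOfReflex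
import Literature.NumberTheory.ComplexMultiplication.CMGaloisSubfield
import Literature.NumberTheory.ComplexMultiplication.CMTypeBasic
import HarnessLib

/-!
# Δ2 bridge, orientation audit Q1: the admissibility predicate under `ι₁ ↦ ῑ₁ = conj ∘ ι₁`

The (J3)-dictionary's admissibility predicate `LiuCMSide.IsReflexOfType ι₁ C Φ` ([Liu2021] Def. 4.3 read inside `L` through `ι₁`:
`C` is the reflex side of the CM type `Φ` of `L`) and its Galois-guarded form `IsReflexOfTypeG` are keyed by the complex embedding
`ι₁`.  The Δ2 bridge's (c)+(d) value is forced by the geometry to the CONJUGATE embedding `ῑ₁ := conj ∘ ι₁` (the tree's cofan of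
`X_K ⊗_{E,ῑ₁} ℂ`, `CorCM/D2Bridge/AlbaneseOnPieceCofan.lean`).  This file decides, in the kernel and for every Galois CM field `L`,
how the predicate transforms:

* `autSet_starRingEnd_comp` — `autSet ῑ₁ Φ = autSet ι₁ Φ̄` (`Φ̄ = bar Φ`, the conjugate type): definitional bookkeeping
  (`ι₁ ∘ g ∈ Φ̄ ↔ conj ∘ ι₁ ∘ g ∈ Φ`).
* `mem_reflexTypeC_starRingEnd_comp_iff` — the package reflex type read through `ῑ₁` is the conjugate of the one read through `ι₁`.
* `isReflexOf_starRingEnd_comp_iff` — at a FIXED `L`-type `T ⊆ Aut_ℚ(L)`: `C.IsReflexOf ῑ₁ T ↔ C.IsReflexOf ι₁ T` (`L/ℚ` Galois CM: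
  complex conjugation `ρ ∈ Gal(L/ℚ)` is central, so the reflex field `reflexFieldOf T ≤ L` is `ρ`-stable and `ρ|` is the complex
  conjugation of EVERY complex embedding of it — tree `conjGalRestrict`, `isConj_conjGalRestrict`; the witness `ε` is replaced by
  `ε` followed by `ρ|`).
* `isReflexOfType_starRingEnd_comp_iff` — **`C.IsReflexOfType ῑ₁ Φ ↔ C.IsReflexOfType ι₁ Φ̄`**, and the `G` form
  `isReflexOfTypeG_starRingEnd_comp_iff`: reading the SAME record through the conjugate pin embedding is admissibility for the
  CONJUGATE type — the «Φ̄ form» of DECISION #13 (iii); the «same-Φ form» is therefore false whenever `Φ̄`- and `Φ`-admissibility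
  differ (e.g. `L` imaginary quadratic, `Φ = {ι₁}`: `Φ' = {τ ∘ k}` versus `Φ' = {conj ∘ τ ∘ k}`).

References: [Liu2021] Y. Liu, arXiv:2102.11518 = Camb. J. Math. 9 (2021), Def. 4.3 (TeX l. 1914–1921), Rem. 4.4 (l. 1930–1933:
`M'_{μ^c} = M'_μ`, `Ψ_{μ^c}` the opposite type); [Shimura1998] G. Shimura, *Abelian Varieties with Complex Multiplication and Modular
Functions*, §8.3 Prop. 28; [Streng2010] M. Streng, *Complex multiplication of abelian surfaces*, Ch. I Lemma 2.2 (d).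
-/

set_option autoImplicit false

noncomputable section

namespace Summit.HodgeConjecture.CorCM.D2Bridge

open scoped Pointwise
open NumberField NumberField.ComplexEmbedding
open Literature.AlgebraicGeometry.Motives (CMType)
open Literature.NumberTheory.ComplexMultiplication
open Literature.NumberTheory.ComplexMultiplication.CMTypeOps (bar mem_bar_iff conjugate_mem_iff_notMem)
open HodgeCM.Model (LiuCMSide)
open Literature.NumberTheory.Automorphic.PicardCM (CMAbelianVarietyRealised)
open HodgeCM.Model.LiuCMSide (autImage reflexFieldOf reflexTypeC autSet)

variable {L : HodgeCM.CMField} (ι₁ : L →+* ℂ)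

/-! ## §1 The type set and the package reflex type under `ι₁ ↦ ῑ₁` -/

/-- **`autSet ῑ₁ Φ = autSet ι₁ Φ̄`**: reading `Φ` in `Aut_ℚ(L)` through `ῑ₁ = conj ∘ ι₁` is reading the conjugate type `Φ̄` through
`ι₁` (`conj ∘ ι₁ ∘ g ∈ Φ ↔ ι₁ ∘ g ∉ Φ ↔ ι₁ ∘ g ∈ Φ̄`). [cite: Liu2021, Remark 4.4 (TeX ll. 1930–1933)] -/
theorem autSet_starRingEnd_comp (Φ : CMType L) :
    autSet ((starRingEnd ℂ).comp ι₁) Φ = autSet ι₁ (bar Φ) := by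
  ext g
  change ((starRingEnd ℂ).comp ι₁).comp g.toRingEquiv.toRingHom ∈ Φ.1 ↔ ι₁.comp g.toRingEquiv.toRingHom ∈ (bar Φ).1
  have h : ((starRingEnd ℂ).comp ι₁).comp g.toRingEquiv.toRingHom = conjugate (ι₁.comp g.toRingEquiv.toRingHom) :=
    RingHom.ext fun _ => rfl
  rw [h, conjugate_mem_iff_notMem, mem_bar_iff]

/-- The package reflex type through `ῑ₁` is the conjugate of the one through `ι₁`:
`ψ ∈ reflexTypeC ῑ₁ T ↔ ψ̄ ∈ reflexTypeC ι₁ T` (both are restrictions of `ι ∘ g`, `g ∈ S̃*`). [cite: Shimura1998, §8.3 Prop. 28] -/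
theorem mem_reflexTypeC_starRingEnd_comp_iff (T : Set (L ≃ₐ[ℚ] L)) (ψ : ↥(reflexFieldOf T) →+* ℂ) :
    ψ ∈ reflexTypeC ((starRingEnd ℂ).comp ι₁) T ↔ conjugate ψ ∈ reflexTypeC ι₁ T := by
  constructor
  · rintro ⟨g, hg, rfl⟩
    exact ⟨g, hg, RingHom.ext fun x => by
      simp only [conjugate_coe_eq, RingHom.coe_comp, Function.comp_apply, starRingEnd_self_apply]⟩
  · rintro ⟨g, hg, h⟩
    refine ⟨g, hg, RingHom.ext fun x => ?_⟩
    have hx := congrArg (fun χ : ↥(reflexFieldOf T) →+* ℂ => starRingEnd ℂ (χ x)) h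
    simpa only [conjugate_coe_eq, starRingEnd_self_apply, RingHom.coe_comp, Function.comp_apply] using hx

/-! ## §2 `IsReflexOf` does not see the conjugation of the pin at a FIXED type set -/

/-- `ι₁ (ρ x) = conj (ι₁ x)` for the complex conjugation `ρ = conjGal` of the CM field `L`. [folklore] -/
theorem apply_conjGal_eq_conj (x : L) : ι₁ ((conjGal : L ≃ₐ[ℚ] L) x) = starRingEnd ℂ (ι₁ x) := by
  rw [conjGal_apply, IsCMField.complexEmbedding_complexConj]

section Galois

variable [IsGalois ℚ L]

/-- The restricted conjugation `ρ|` of an intermediate field followed by `ι₁ ∘ incl` is `ῑ₁ ∘ incl`. [folklore] -/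
theorem comp_algebraMap_comp_conjGalRestrict (E : IntermediateField ℚ L) :
    (ι₁.comp (algebraMap (↥E) L)).comp (conjGalRestrict E : ↥E →+* ↥E) =
      ((starRingEnd ℂ).comp ι₁).comp (algebraMap (↥E) L) :=
  RingHom.ext fun x => by
    simp only [RingHom.coe_comp, Function.comp_apply, RingHom.coe_coe, IntermediateField.algebraMap_apply,
      coe_conjGalRestrict_apply, apply_conjGal_eq_conj]

/-- `ρ|` is an involution of the intermediate field (pointwise). [folklore] -/
@[simp] theorem conjGalRestrict_apply_apply (E : IntermediateField ℚ L) (x : ↥E) :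
    conjGalRestrict E (conjGalRestrict E x) = x :=
  Subtype.ext (by simp only [coe_conjGalRestrict_apply, conjGal_apply, IsCMField.complexConj_apply_apply])

/-- `ρ|` is an involution of the intermediate field (`symm` form). [folklore] -/
theorem conjGalRestrict_symm (E : IntermediateField ℚ L) : (conjGalRestrict E).symm = conjGalRestrict E :=
  AlgEquiv.ext fun x => by rw [AlgEquiv.symm_apply_eq, conjGalRestrict_apply_apply]

/-- Precomposing a complex embedding of an intermediate field with `ρ|` conjugates it (`isConj_conjGalRestrict`). [folklore] -/
theorem comp_conjGalRestrict_eq_conjugate (E : IntermediateField ℚ L) (χ : ↥E →+* ℂ) :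
    χ.comp (conjGalRestrict E : ↥E →+* ↥E) = conjugate χ :=
  (show conjugate χ = χ.comp (conjGalRestrict E : ↥E →+* ↥E) from isConj_conjGalRestrict E χ).symm

/-- **`IsReflexOf` through `ῑ₁` = `IsReflexOf` through `ι₁`, at a fixed `L`-type `T`.**  For `L/ℚ` Galois CM: if `ε : K' ≃ K*_T`
witnesses `C.IsReflexOf ι₁ T` then `ε` followed by `ρ|_{K*_T}` witnesses `C.IsReflexOf ῑ₁ T`, and conversely (clause (i):
`ι₁ ∘ incl ∘ ρ| = ῑ₁ ∘ incl`; clause (ii): `reflexTypeC ῑ₁ T = conj ∘ reflexTypeC ι₁ T` and `χ ∘ ρ| = χ̄`).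
[cite: Shimura1998, §8.3 Prop. 28] [cite: Streng2010, Ch. I Lemma 2.2 (d)] -/
theorem isReflexOf_starRingEnd_comp_iff (C : LiuCMSide) (T : Set (L ≃ₐ[ℚ] L)) :
    C.IsReflexOf ((starRingEnd ℂ).comp ι₁) T ↔ C.IsReflexOf ι₁ T := by
  constructor
  · rintro ⟨ε, h1, h2⟩
    refine ⟨ε.trans (conjGalRestrict (reflexFieldOf T)).toRingEquiv, ?_, fun ψ => ?_⟩
    · -- clause (i): `τ ∘ k = ῑ₁ ∘ incl ∘ ε = ι₁ ∘ incl ∘ (ρ| ∘ ε)`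
      rw [h1]
      exact RingHom.ext fun x => by
        simp only [RingHom.coe_comp, Function.comp_apply, RingEquiv.toRingHom_eq_coe, RingHom.coe_coe,
          RingEquiv.coe_trans, AlgEquiv.coe_ringEquiv, IntermediateField.algebraMap_apply,
          coe_conjGalRestrict_apply, apply_conjGal_eq_conj]
    · -- clause (ii): `ψ ∘ (ρ| ∘ ε)⁻¹ = (ψ ∘ ε⁻¹) ∘ ρ| = conj ∘ (ψ ∘ ε⁻¹)`
      rw [h2 ψ, mem_reflexTypeC_starRingEnd_comp_iff]
      refine Iff.of_eq (congrArg (fun χ => χ ∈ reflexTypeC ι₁ T) ?_)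
      rw [← comp_conjGalRestrict_eq_conjugate]
      exact RingHom.ext fun x => by
        simp only [RingHom.coe_comp, Function.comp_apply, RingEquiv.toRingHom_eq_coe, RingHom.coe_coe,
          RingEquiv.symm_trans_apply, AlgEquiv.coe_ringEquiv, AlgEquiv.toRingEquiv_symm, conjGalRestrict_symm]
  · rintro ⟨ε, h1, h2⟩
    refine ⟨ε.trans (conjGalRestrict (reflexFieldOf T)).toRingEquiv, ?_, fun ψ => ?_⟩
    · rw [h1]
      exact RingHom.ext fun x => by
        simp only [RingHom.coe_comp, Function.comp_apply, RingEquiv.toRingHom_eq_coe, RingHom.coe_coe,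
          RingEquiv.coe_trans, AlgEquiv.coe_ringEquiv, IntermediateField.algebraMap_apply,
          coe_conjGalRestrict_apply, apply_conjGal_eq_conj, starRingEnd_self_apply]
    · rw [h2 ψ, mem_reflexTypeC_starRingEnd_comp_iff, ← comp_conjGalRestrict_eq_conjugate]
      refine Iff.of_eq (congrArg (fun χ => χ ∈ reflexTypeC ι₁ T) ?_)
      exact RingHom.ext fun x => by
        simp only [RingHom.coe_comp, Function.comp_apply, RingEquiv.toRingHom_eq_coe, RingHom.coe_coe,
          RingEquiv.symm_trans_apply, AlgEquiv.coe_ringEquiv, AlgEquiv.toRingEquiv_symm, conjGalRestrict_symm,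
          conjGalRestrict_apply_apply]

/-! ## §3 Q1: the admissibility predicate through `ῑ₁` is admissibility for the CONJUGATE type -/

/-- **DECISION #13 (iii), Φ̄ form, in the kernel: `C.IsReflexOfType ῑ₁ Φ ↔ C.IsReflexOfType ι₁ Φ̄`.**  Reading the SAME CM record
`C` through the conjugate pin embedding `ῑ₁ = conj ∘ ι₁` is admissibility for the conjugate type `Φ̄` through `ι₁`
([Liu2021] Rem. 4.4: `M'_{μ^c} = M'_μ` with the OPPOSITE reflex type `Ψ_{μ^c}`).
[cite: Liu2021, Definition 4.3 (TeX ll. 1914–1921) and Remark 4.4 (ll. 1930–1933)] [cite: Shimura1998, §8.3 Prop. 28] -/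
theorem isReflexOfType_starRingEnd_comp_iff (C : LiuCMSide) (Φ : CMType L) :
    C.IsReflexOfType ((starRingEnd ℂ).comp ι₁) Φ ↔ C.IsReflexOfType ι₁ (bar Φ) := by
  unfold LiuCMSide.IsReflexOfType
  rw [autSet_starRingEnd_comp, isReflexOf_starRingEnd_comp_iff]

end Galois

/-- **The Galois-guarded form: `C.IsReflexOfTypeG ῑ₁ Φ ↔ C.IsReflexOfTypeG ι₁ Φ̄`** — so the landed S1 junction
(`HcmS1PinJunction.exists_dLiu_of_objOne`, keyed `hinst : algebraMap = ι₁`), re-run verbatim at `ῑ₁`, would certify its records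
admissible for `Φ̄_μ`, not for the dictionary's `adm i := IsReflexOfTypeG ι₁ (typeOfLine (line i))` (`= … ι₁ Φ_{μ_i}`):
the Version-C re-key must conjugate the RECORD (its `M_μ`-action), not the pin. [cite: Liu2021, Remark 4.4 (TeX ll. 1930–1933)] -/
theorem isReflexOfTypeG_starRingEnd_comp_iff (C : LiuCMSide) (Φ : CMType L) :
    C.IsReflexOfTypeG ((starRingEnd ℂ).comp ι₁) Φ ↔ C.IsReflexOfTypeG ι₁ (bar Φ) := by
  unfold LiuCMSide.IsReflexOfTypeG
  exact forall_congr' fun hG => by haveI := hG; exact isReflexOfType_starRingEnd_comp_iff ι₁ C Φ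

/-! ## §4 Orientation of an admissible record's class: `ι₁ ∈ Φ` puts `τ ∘ k` IN the reflex type, `ι₁ ∈ Φ̄`-admissibility puts it OUT -/

section Orientation

/-- `1 ∈ autSet ι₁ Φ ↔ ι₁ ∈ Φ`. [folklore] -/
theorem one_mem_autSet_iff (Φ : CMType L) : (1 : L ≃ₐ[ℚ] L) ∈ autSet ι₁ Φ ↔ ι₁ ∈ Φ.1 := by
  change ι₁.comp (1 : L ≃ₐ[ℚ] L).toRingEquiv.toRingHom ∈ Φ.1 ↔ ι₁ ∈ Φ.1
  exact Iff.of_eq (congrArg (fun χ => χ ∈ Φ.1) (RingHom.ext fun _ => rfl))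

/-- `ι₁ ∘ incl ∈ reflexTypeC ι₁ (autSet ι₁ Φ)` as soon as `ι₁ ∈ Φ` (witness `g = 1 ∈ S̃*`). [cite: Shimura1998, §8.3 Prop. 28] -/
theorem comp_algebraMap_mem_reflexTypeC_of_mem (Φ : CMType L) (hι : ι₁ ∈ Φ.1) :
    ι₁.comp (algebraMap (↥(reflexFieldOf (autSet ι₁ Φ))) L) ∈ reflexTypeC ι₁ (autSet ι₁ Φ) := by
  refine ⟨1, ?_, RingHom.ext fun _ => rfl⟩
  rw [mem_reflexLift, inv_one, one_smul]
  exact ⟨1, (one_mem_autSet_iff ι₁ Φ).2 hι, rfl⟩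

/-- **ORIENTATION OF ADMISSIBLE RECORDS.**  If the CM record `d` is admissible for `Φ` through `ι₁` (`d.IsReflexOfType ι₁ Φ`) and
`ι₁ ∈ Φ` (the dictionary's `PhiMu`), then its eigencharacter restricted to the reflex field lies IN the reflex type: `d.τ ∘ d.k ∈ d.Φ'`,
hence `d.τ ∈ d.ΦA` (`d.hΦA`) — by `IsCMTypeRealisation` the class `d.α` (a `d.τ`-eigenvector) is of Hodge type `(1,0)`, and so is every
pull-back `f^* d.α` in `geomClass K d`.  [cite: Liu2021, Definition 4.3 (TeX ll. 1914–1921)] [cite: Shimura1998, §8.3 Prop. 28] -/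
theorem tau_comp_k_mem_of_isReflexOfType (d : LiuCMSide) (Φ : CMType L) (h : d.IsReflexOfType ι₁ Φ) (hι : ι₁ ∈ Φ.1) :
    d.τ.comp d.k ∈ d.Φ' := by
  obtain ⟨ε, h1, h2⟩ := h
  rw [h2, h1]
  have hcomp : ((ι₁.comp (algebraMap (↥(reflexFieldOf (autSet ι₁ Φ))) L)).comp ε.toRingHom).comp ε.symm.toRingHom =
      ι₁.comp (algebraMap (↥(reflexFieldOf (autSet ι₁ Φ))) L) :=
    RingHom.ext fun x => by
      simp only [RingHom.coe_comp, Function.comp_apply, RingEquiv.toRingHom_eq_coe, RingHom.coe_coe, RingEquiv.apply_symm_apply]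
  rw [hcomp]
  exact comp_algebraMap_mem_reflexTypeC_of_mem ι₁ Φ hι

/-- The same on the realised CM type: `d.τ ∈ d.ΦA` — the record's class `d.α ∈ eigenline θA d.τ` is of Hodge type `(1,0)`
(`IsCMTypeRealisation`, clause for `σ ∈ Φ`). [cite: Shimura1998, §5.2 (pp. 36–37)] -/
theorem tau_mem_cmType_of_isReflexOfType (d : LiuCMSide) (Φ : CMType L) (h : d.IsReflexOfType ι₁ Φ) (hι : ι₁ ∈ Φ.1) :
    d.τ ∈ d.ΦA.1 :=
  (d.hΦA d.τ).2 (tau_comp_k_mem_of_isReflexOfType ι₁ d Φ h hι)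

/-- The `(1,0)` statement read through the conjugate pin: if `d.IsReflexOfType ῑ₁ Φ` and `ῑ₁ ∈ Φ` then `d.τ ∈ d.ΦA`.
[cite: Shimura1998, §8.3 Prop. 28] -/
theorem tau_mem_cmType_of_isReflexOfType_starRingEnd_comp (d : LiuCMSide) (Φ : CMType L)
    (h : d.IsReflexOfType ((starRingEnd ℂ).comp ι₁) Φ) (hι : (starRingEnd ℂ).comp ι₁ ∈ Φ.1) : d.τ ∈ d.ΦA.1 :=
  tau_mem_cmType_of_isReflexOfType ((starRingEnd ℂ).comp ι₁) d Φ h hι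

/-- If an element `g` of the lifted reflex type `S̃*(T)` fixes the reflex field `K*_T` pointwise, then `1 ∈ T`: `g` lies in
`Gal(L/K*_T)`, which is the stabiliser of the type (Galois correspondence, Mathlib `IntermediateField.fixingSubgroup_fixedField`), so
`id = g • (g⁻¹ • id) ∈ g • T = T`. [cite: Shimura1998, §8.3 Prop. 28] -/
theorem one_mem_of_mem_reflexLift_of_forall_apply_eq (T : Set (L ≃ₐ[ℚ] L)) (g : L ≃ₐ[ℚ] L)
    (hg : g ∈ (reflexLift (autImage T) (AlgHom.id ℚ L) : Set (L ≃ₐ[ℚ] L)))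
    (hfix : ∀ x : L, x ∈ reflexFieldOf T → g x = x) : (1 : L ≃ₐ[ℚ] L) ∈ T := by
  have hstab : g ∈ MulAction.stabilizer (L ≃ₐ[ℚ] L) (autImage T) := by
    rw [← IntermediateField.fixingSubgroup_fixedField (MulAction.stabilizer (L ≃ₐ[ℚ] L) (autImage T))]
    exact (IntermediateField.mem_fixingSubgroup_iff _ _).2 hfix
  rw [mem_reflexLift] at hg
  have hS : g • autImage T = autImage T := MulAction.mem_stabilizer_iff.1 hstab
  have hmem : (AlgHom.id ℚ L : L →ₐ[ℚ] L) ∈ autImage T := by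
    have h' : g • (g⁻¹ • (AlgHom.id ℚ L : L →ₐ[ℚ] L)) ∈ g • autImage T := Set.smul_mem_smul_set hg
    rwa [smul_inv_smul, hS] at h'
  obtain ⟨σ, hσ, hσ1⟩ := hmem
  have hσ' : σ = 1 := AlgEquiv.ext fun x => by
    have hx : σ x = x := congrArg (fun φ : L →ₐ[ℚ] L => φ x) hσ1
    exact hx
  exact hσ' ▸ hσ

/-- **ORIENTATION FLIP.**  If the CM record `d` is admissible for the CONJUGATE type `Φ̄` through `ι₁` while `ι₁ ∈ Φ`, then its
eigencharacter restricted to the reflex field lies OUTSIDE the reflex type: `d.τ ∘ d.k ∉ d.Φ'` (a witness `g ∈ S̃*` with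
`ι₁ ∘ g|_{K*} = ι₁|_{K*}` would fix `K*` pointwise, forcing `1 ∈ autSet ι₁ Φ̄`, i.e. `ι₁ ∉ Φ`).  Hence `d.τ ∉ d.ΦA` and, by
`IsCMTypeRealisation`, the class `d.α` is of Hodge type `(0,1)`. [cite: Shimura1998, §8.3 Prop. 28] -/
theorem tau_comp_k_notMem_of_isReflexOfType_bar (d : LiuCMSide) (Φ : CMType L) (h : d.IsReflexOfType ι₁ (bar Φ))
    (hι : ι₁ ∈ Φ.1) : d.τ.comp d.k ∉ d.Φ' := by
  obtain ⟨ε, h1, h2⟩ := h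
  rw [h2, h1]
  have hcomp : ((ι₁.comp (algebraMap (↥(reflexFieldOf (autSet ι₁ (bar Φ)))) L)).comp ε.toRingHom).comp ε.symm.toRingHom =
      ι₁.comp (algebraMap (↥(reflexFieldOf (autSet ι₁ (bar Φ)))) L) :=
    RingHom.ext fun x => by
      simp only [RingHom.coe_comp, Function.comp_apply, RingEquiv.toRingHom_eq_coe, RingHom.coe_coe, RingEquiv.apply_symm_apply]
  rw [hcomp]
  rintro ⟨g, hg, hEq⟩
  have hfix : ∀ x : L, x ∈ reflexFieldOf (autSet ι₁ (bar Φ)) → g x = x := fun x hx => by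
    have hx' := congrArg (fun χ : ↥(reflexFieldOf (autSet ι₁ (bar Φ))) →+* ℂ => χ ⟨x, hx⟩) hEq
    simp only [RingHom.coe_comp, Function.comp_apply, IntermediateField.algebraMap_apply, RingHom.coe_coe] at hx'
    exact (ι₁.injective hx').symm
  have h1T := one_mem_of_mem_reflexLift_of_forall_apply_eq (autSet ι₁ (bar Φ)) g hg hfix
  rw [one_mem_autSet_iff, mem_bar_iff] at h1T
  exact h1T hι

/-- The same on the realised CM type: `d.τ ∉ d.ΦA` — the record's class is of Hodge type `(0,1)`. [cite: Shimura1998, §5.2 (pp. 36–37)] -/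
theorem tau_notMem_cmType_of_isReflexOfType_bar (d : LiuCMSide) (Φ : CMType L) (h : d.IsReflexOfType ι₁ (bar Φ))
    (hι : ι₁ ∈ Φ.1) : d.τ ∉ d.ΦA.1 :=
  fun hτ => tau_comp_k_notMem_of_isReflexOfType_bar ι₁ d Φ h hι ((d.hΦA d.τ).1 hτ)

/-- **THE AUDIT'S PARITY STATEMENT.**  Through the CONJUGATE pin `ῑ₁ = conj ∘ ι₁` — the embedding along which the tree's surfaces
`P_Γ(V)` sit in `X_K ⊗ ℂ` — a record admissible for `Φ` with `ι₁ ∈ Φ` (the dictionary's `PhiMu`) carries a class of Hodge type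
`(0,1)`: `d.IsReflexOfType ῑ₁ Φ → ι₁ ∈ Φ → d.τ ∉ d.ΦA`; whereas through `ι₁` (`tau_mem_cmType_of_isReflexOfType`) it is `(1,0)`.
[cite: Liu2021, Remark 4.4 (TeX ll. 1930–1933)] [cite: Shimura1998, §8.3 Prop. 28] -/
theorem tau_notMem_cmType_of_isReflexOfType_starRingEnd_comp [IsGalois ℚ L] (d : LiuCMSide) (Φ : CMType L)
    (h : d.IsReflexOfType ((starRingEnd ℂ).comp ι₁) Φ) (hι : ι₁ ∈ Φ.1) : d.τ ∉ d.ΦA.1 :=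
  tau_notMem_cmType_of_isReflexOfType_bar ι₁ d Φ ((isReflexOfType_starRingEnd_comp_iff ι₁ d Φ).1 h) hι

end Orientation

/-! ## §5 Consequence: the (d)-side junction hypothesis at the conjugate pin is REFUTABLE for `PhiMu` lines -/

section Refutation

variable [IsGalois ℚ L]

/-- **`hadmμ` at `ιg := ῑ₁` is FALSE.**  For `L/ℚ` Galois CM, the universe record `hCM : CMAbelianVarietyRealised` and ANY CM type `Φ`
with `ι₁ ∈ Φ` (the dictionary's `PhiMu`): it is NOT the case that every record admissible for `Φ` through `ῑ₁` is admissible for `Φ`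
through `ι₁` — the tree's own admissible record `LiuCMSide.ofReflex ῑ₁ hCM Φ` (`LiuCMSideOfReflex.lean`) is a witness: `ῑ₁`-admissibility
puts its eigencharacter OUT of its CM type (`tau_notMem_cmType_of_isReflexOfType_starRingEnd_comp`, type (0,1)), `ι₁`-admissibility would put it
IN (type (1,0)).  This is the displayed binder `hadmμ : ∀ d, d.IsReflexOfTypeG ῑ₁ Φ_{μ_i} → d.IsReflexOfTypeG ι₁ (typeOfLine (line i))` of the
`ιg`-generic pieces composition (prove-3 re-cut, `HcmPiecesAtPin`, pub-hodgecm2/INBOX l.11378) at `ιg := ῑ₁`, with `typeOfLine (line i) = Φ_{μ_i}`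
(✔ `cmType_eq_lineType_of_deltaPos`): REFUTED, so that composition cannot be displayed honestly at the geometric pin without re-keying `adm`.
[cite: Liu2021, Remark 4.4 (TeX ll. 1930–1933)] [cite: Shimura1998, §8.3 Prop. 28] -/
theorem not_forall_isReflexOfType_starRingEnd_comp_imp (hCM : CMAbelianVarietyRealised) (Φ : CMType L) (hι : ι₁ ∈ Φ.1) :
    ¬ ∀ d : LiuCMSide, d.IsReflexOfType ((starRingEnd ℂ).comp ι₁) Φ → d.IsReflexOfType ι₁ Φ := by
  intro h
  obtain ⟨d, hd, -⟩ := LiuCMSide.exists_isReflexOfType_α_ne_zero ((starRingEnd ℂ).comp ι₁) hCM Φ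
  exact tau_notMem_cmType_of_isReflexOfType_starRingEnd_comp ι₁ d Φ hd hι
    (tau_mem_cmType_of_isReflexOfType ι₁ d Φ (h d hd) hι)

/-- The Galois-guarded form (the literal shape of `hadmμ`). [cite: Liu2021, Remark 4.4 (TeX ll. 1930–1933)] -/
theorem not_forall_isReflexOfTypeG_starRingEnd_comp_imp (hCM : CMAbelianVarietyRealised) (Φ : CMType L) (hι : ι₁ ∈ Φ.1) :
    ¬ ∀ d : LiuCMSide, d.IsReflexOfTypeG ((starRingEnd ℂ).comp ι₁) Φ → d.IsReflexOfTypeG ι₁ Φ := by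
  intro h
  refine not_forall_isReflexOfType_starRingEnd_comp_imp ι₁ hCM Φ hι fun d hd => ?_
  exact h d (fun _ => hd) inferInstance

end Refutation

end Summit.HodgeConjecture.CorCM.D2Bridge

end
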